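import Literature.NumberTheory.Sieve.ShiuDivisorClass
import HarnessLib

/-!
# Zhang (2022) §7/§12: short logarithmic windows of the `S_j`-weight majorant `∏_{q∣k}(1 + c/q)/k`

Topic `Literature/NumberTheory/LFunctions/Zhang2022` (Landau–Siegel audit tree; verdict-neutral).
Y. Zhang, *Discrete mean estimates and the Landau–Siegel zero*, arXiv:2211.02515v1 (2022)
[Zhang2022LandauSiegel], §7 p. 33 (Prop. 7.1: the arithmetic sums
`S_j(𝐚₁,𝐚₂) = Σ_dΣ_r |μ(r)|λ₀ⱼ(dr)/(drφ(r))(…)(…)`) and §12 pp. 66–67 ((12.6)/(12.8), the window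
sequences of `H₁₅ − H̃₁₅`) — **an unrefereed manuscript under adjudication; nothing here asserts or
denies its Theorems 1–2.** ZHANG-L discharge lane, WP12 helper under leaf hXi
`Typed.Sec12A.Xi15Hbar16 c′` (cores hS/hS′: `S_j(𝐛,𝐛̄) = o(α𝔞)` for `O(1)` window coefficients).

After grouping `n = dr` the `S_j`-weights are majorised by `2∏_{q∣n}(1 + c/q)/n` (tree
`Section8FrontEnd44Weights.weight_antidiagonal_le`, `c = 106`; `c = 430` with the relative factor,
`Section8FrontEnd44ReductionRel.weight_antidiagonal_rel_le`). The degenerate-window regime of the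
`O(1)`-coefficient bound (`WindowPairs.degenerate_regime_le`) needs the total weight on a SHORT
logarithmic window `|log(km/X)| ≤ θ` (`θ = 𝓛⁻¹⁰`) to be `O(θ)` — a short-interval mean of the
multiplicative function `k ↦ ∏_{q∣k}(1 + c/q)`, which lies in Shiu's divisor class with prime values
`1 + c/q` (exponent `a = 1`). THEOREMS ONLY (the weight is written as an explicit product; no `def`):

* `prodWeight_mul_of_coprime`, `prodWeight_prime_pow`, `prodWeight_nonneg` — class membership;
* `prodWeight_shortLogMean` — Shiu (tree `Sieve.ShiuDivisorClass.shiu_divisor_class_logMean_Ioc`,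
  `a = 1`, `d = 0`): `Σ_{x<k≤x'} ∏_{q∣k}(1+c/q)/k ≤ C·((x' − x)/x)` for `x ≥ x₀`, `x + x^{1/4} ≤ x' ≤ 2x`;
* `window_weight_le` — **`Σ_{k∈K, |log(km/X)|≤θ} ∏_{q∣k}(1+c/q)/k ≤ C·θ`** whenever the window sits
  at height `x = Xe^{−2θ}/m ≥ x₀` with `x^{1/4} ≤ x(e^{3θ} − 1)` and `0 < θ ≤ 1/10` (the hypothesis
  `hωk` of `WindowPairs.degenerate_regime_le`, with `ω = C·θ`).

## References

* Y. Zhang, arXiv:2211.02515v1 (2022), §7 Prop. 7.1 p.33; §12 pp.66–67.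
  [cite: Zhang2022LandauSiegel, §12 (12.6) p.67]
* P. Shiu, *A Brun–Titchmarsh theorem for multiplicative functions*, J. reine angew. Math. 313 (1980),
  161–170, Theorem 1 (tree `Literature.NumberTheory.Sieve.shiu_uniform`). [cite: Shiu1980, Thm 1]
-/

noncomputable section

open Finset Real
open scoped Classical

namespace Literature.NumberTheory.LFunctions.Zhang2022.WeightShortWindow

open Literature.NumberTheory.Sieve

/-! ## The weight `∏_{q∣k}(1 + c/q)` is in Shiu's divisor class -/

/-- Multiplicativity on coprime arguments: `∏_{q∣mn}(1+c/q) = ∏_{q∣m}(1+c/q)·∏_{q∣n}(1+c/q)` for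
`(m,n) = 1`. [cite: Zhang2022LandauSiegel, §7 Prop. 7.1 p.33] -/
theorem prodWeight_mul_of_coprime (c : ℝ) {m n : ℕ} (hmn : Nat.Coprime m n) :
    (∏ q ∈ (m * n).primeFactors, (1 + c / (q : ℝ))) =
      (∏ q ∈ m.primeFactors, (1 + c / (q : ℝ))) * ∏ q ∈ n.primeFactors, (1 + c / (q : ℝ)) := by
  rcases Nat.eq_zero_or_pos m with hm | hm
  · subst hm
    have hn : n = 1 := by simpa using hmn
    subst hn
    simp
  rcases Nat.eq_zero_or_pos n with hn | hn
  · subst hn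
    have hm1 : m = 1 := by simpa using hmn
    subst hm1
    simp
  rw [Nat.primeFactors_mul hm.ne' hn.ne', Finset.prod_union hmn.disjoint_primeFactors]

/-- At a prime power: `∏_{q∣p^ν}(1+c/q) = 1 + c/p ≤ (1 + c)·(ν+1)⁰` (`ν ≥ 1`, `c ≥ 0`).
[cite: Zhang2022LandauSiegel, §7 Prop. 7.1 p.33] -/
theorem prodWeight_prime_pow {c : ℝ} (hc : 0 ≤ c) {p ν : ℕ} (hp : p.Prime) (hν : 1 ≤ ν) :
    (∏ q ∈ (p ^ ν).primeFactors, (1 + c / (q : ℝ))) ≤ (1 + c) * ((ν : ℝ) + 1) ^ 0 := by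
  rw [Nat.primeFactors_prime_pow (by omega) hp, Finset.prod_singleton, pow_zero, mul_one]
  have hp1 : (1 : ℝ) ≤ p := by exact_mod_cast hp.one_lt.le
  have : c / (p : ℝ) ≤ c := div_le_self hc hp1
  linarith

/-- Nonnegativity of the weight. [cite: Zhang2022LandauSiegel, §7 Prop. 7.1 p.33] -/
theorem prodWeight_nonneg {c : ℝ} (hc : 0 ≤ c) (n : ℕ) :
    0 ≤ ∏ q ∈ n.primeFactors, (1 + c / (q : ℝ)) :=
  Finset.prod_nonneg fun q _ => by positivity

/-- The prime values: `∏_{q∣p}(1+c/q) = 1 + 0·log p + c/p` — exponent `a = 1` in Shiu's bound.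
[cite: Zhang2022LandauSiegel, §7 Prop. 7.1 p.33] -/
theorem prodWeight_prime (c : ℝ) {p : ℕ} (hp : p.Prime) :
    (∏ q ∈ p.primeFactors, (1 + c / (q : ℝ))) = ((1 : ℕ) : ℝ) + 0 * Real.log p + c / p := by
  rw [Nat.Prime.primeFactors hp, Finset.prod_singleton]
  push_cast
  ring

/-! ## Shiu on short windows -/

/-- **Short logarithmic means of the weight (Shiu, `a = 1`).** For `c ≥ 0` there are `C ≥ 0`,
`x₀ ≥ 2` with `Σ_{x<k≤x'} ∏_{q∣k}(1+c/q)/k ≤ C·((x' − x)/x)` for all `x ≥ x₀`, `x + x^{1/4} ≤ x' ≤ 2x`.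
[cite: Zhang2022LandauSiegel, §7 Prop. 7.1 p.33] -/
theorem prodWeight_shortLogMean {c : ℝ} (hc : 0 ≤ c) :
    ∃ C x₀ : ℝ, 0 ≤ C ∧ 2 ≤ x₀ ∧ ∀ x x' : ℝ, x₀ ≤ x → x + x ^ (1 / 4 : ℝ) ≤ x' → x' ≤ 2 * x →
      ∑ k ∈ Finset.Ioc ⌊x⌋₊ ⌊x'⌋₊, (∏ q ∈ k.primeFactors, (1 + c / (q : ℝ))) / k ≤
        C * ((x' - x) / x) := by
  obtain ⟨C, x₀, hC0, hx₀, h⟩ := ShiuDivisorClass.shiu_divisor_class_logMean_Ioc 1 0 (1 + c)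
  refine ⟨C * Real.exp c, x₀, by positivity, hx₀, fun x x' hx hxx' hx'x => ?_⟩
  have hx2 : 2 ≤ x := hx₀.trans hx
  have hlog : 0 < Real.log x := Real.log_pos (by linarith)
  have key := h (fun k => ∏ q ∈ k.primeFactors, (1 + c / (q : ℝ))) (prodWeight_nonneg hc)
    (fun m n hmn => prodWeight_mul_of_coprime c hmn)
    (fun p ν hp hν => prodWeight_prime_pow hc hp hν) 0 c le_rfl hc x x' hx hxx' hx'x
    (fun p hp _ => (prodWeight_prime c hp).le)
  rw [zero_mul, zero_add, pow_one] at key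
  calc _ ≤ C * Real.exp c * ((x' - x) / x) * Real.log x / Real.log x := key
    _ = C * Real.exp c * ((x' - x) / x) := by field_simp

/-- `e^u − 1 ≤ 3u` for `0 ≤ u ≤ 1`. [folklore] -/
private theorem exp_sub_one_le_three_mul {u : ℝ} (hu0 : 0 ≤ u) (hu1 : u ≤ 1) :
    Real.exp u - 1 ≤ 3 * u := by
  have hpos : 0 < Real.exp u := Real.exp_pos _
  have hineq := Real.add_one_le_exp (-u)
  rw [Real.exp_neg] at hineq
  have h2 : (-u + 1) * Real.exp u ≤ 1 := by
    have := mul_le_mul_of_nonneg_right hineq hpos.le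
    rwa [inv_mul_cancel₀ hpos.ne'] at this
  have h3 : Real.exp u ≤ Real.exp 1 := Real.exp_le_exp.mpr hu1
  have h4 : Real.exp 1 < 3 := lt_trans Real.exp_one_lt_d9 (by norm_num)
  nlinarith

/-- **The `k`-window weight bound.** For `c ≥ 0` there are `C ≥ 0`, `x₀ ≥ 2` such that: for
`X > 0`, `m ≥ 1`, `0 < θ ≤ 1/10`, with `x := Xe^{−2θ}/m ≥ x₀` and `x^{1/4} ≤ x(e^{3θ} − 1)`, and any
finite `K ⊆ ℕ_{≥1}`,
`Σ_{k∈K, |log(km/X)|≤θ} ∏_{q∣k}(1+c/q)/k ≤ C·θ`.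
(The window `|log(km/X)| ≤ θ` lies in `(x, x']`, `x' = Xe^{θ}/m = xe^{3θ} ≤ 2x`.)
[cite: Zhang2022LandauSiegel, §12 p.67] -/
theorem window_weight_le {c : ℝ} (hc : 0 ≤ c) :
    ∃ C x₀ : ℝ, 0 ≤ C ∧ 2 ≤ x₀ ∧ ∀ (X : ℝ) (m : ℕ) (θ : ℝ), 0 < X → 1 ≤ m → 0 < θ → θ ≤ 1 / 10 →
      x₀ ≤ X * Real.exp (-(2 * θ)) / m →
      (X * Real.exp (-(2 * θ)) / m) ^ (1 / 4 : ℝ) ≤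
        X * Real.exp (-(2 * θ)) / m * (Real.exp (3 * θ) - 1) →
      ∀ K : Finset ℕ, (∀ k ∈ K, 0 < k) →
        ∑ k ∈ K.filter (fun k : ℕ => |Real.log ((k : ℝ) * (m : ℝ) / X)| ≤ θ),
            (∏ q ∈ k.primeFactors, (1 + c / (q : ℝ))) / k ≤ C * θ := by
  obtain ⟨C, x₀, hC0, hx₀, h⟩ := prodWeight_shortLogMean hc
  refine ⟨9 * C, x₀, by positivity, hx₀, fun X m θ hX hm hθ0 hθ5 hx hx4 K hK => ?_⟩
  set x : ℝ := X * Real.exp (-(2 * θ)) / m with hxdef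
  set x' : ℝ := X * Real.exp θ / m with hx'def
  have hmR : (0 : ℝ) < m := by exact_mod_cast hm
  have hxpos : 0 < x := by rw [hxdef]; positivity
  have hx'eq : x' = x * Real.exp (3 * θ) := by
    rw [hxdef, hx'def, div_mul_eq_mul_div, mul_assoc, ← Real.exp_add]
    ring_nf
  have h3θ0 : 0 ≤ 3 * θ := by linarith
  have h3θ1 : 3 * θ ≤ 1 := by linarith
  have hexp3 : Real.exp (3 * θ) - 1 ≤ 3 * (3 * θ) := exp_sub_one_le_three_mul h3θ0 h3θ1
  -- the Shiu window `(x, x']`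
  have hxx' : x + x ^ (1 / 4 : ℝ) ≤ x' := by
    rw [hx'eq]
    have : x ^ (1 / 4 : ℝ) ≤ x * (Real.exp (3 * θ) - 1) := hx4
    nlinarith
  have hx'2x : x' ≤ 2 * x := by
    rw [hx'eq]
    have : Real.exp (3 * θ) ≤ 2 := by linarith
    nlinarith
  have key := h x x' hx hxx' hx'2x
  -- the filtered window lies inside `Ioc ⌊x⌋ ⌊x'⌋`
  have hsub : K.filter (fun k : ℕ => |Real.log ((k : ℝ) * (m : ℝ) / X)| ≤ θ) ⊆
      Finset.Ioc ⌊x⌋₊ ⌊x'⌋₊ := by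
    intro k hk
    rw [Finset.mem_filter] at hk
    obtain ⟨hkK, hk⟩ := hk
    obtain ⟨hlo, hhi⟩ := abs_le.mp hk
    have hk0 : 0 < k := hK k hkK
    have hkR : (0 : ℝ) < k := by exact_mod_cast hk0
    have hq : 0 < (k : ℝ) * (m : ℝ) / X := by positivity
    rw [Finset.mem_Ioc]
    constructor
    · -- `⌊x⌋ < k`: from `x < k`
      have hxk : x < k := by
        have h1 : Real.exp (-θ) ≤ (k : ℝ) * m / X := by
          have := Real.exp_le_exp.mpr hlo
          rwa [Real.exp_log hq] at this
        have h2 : X * Real.exp (-θ) / m ≤ k := by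
          rw [div_le_iff₀ hmR]
          have := (le_div_iff₀ hX).mp h1
          linarith
        have h3 : x < X * Real.exp (-θ) / m := by
          rw [hxdef]
          apply div_lt_div_of_pos_right _ hmR
          apply mul_lt_mul_of_pos_left _ hX
          exact Real.exp_lt_exp.mpr (by linarith)
        linarith
      exact (Nat.floor_lt hxpos.le).mpr hxk
    · -- `k ≤ ⌊x'⌋`: from `k ≤ x'`
      have hkx' : (k : ℝ) ≤ x' := by
        have h1 : (k : ℝ) * m / X ≤ Real.exp θ := by
          have := Real.exp_le_exp.mpr hhi
          rwa [Real.exp_log hq] at this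
        rw [hx'def, le_div_iff₀ hmR]
        have := (div_le_iff₀ hX).mp h1
        linarith
      exact Nat.le_floor hkx'
  have hnonneg : ∀ k ∈ Finset.Ioc ⌊x⌋₊ ⌊x'⌋₊,
      0 ≤ (∏ q ∈ k.primeFactors, (1 + c / (q : ℝ))) / k := fun k _ =>
    div_nonneg (prodWeight_nonneg hc k) (Nat.cast_nonneg k)
  calc ∑ k ∈ K.filter (fun k : ℕ => |Real.log ((k : ℝ) * (m : ℝ) / X)| ≤ θ),
          (∏ q ∈ k.primeFactors, (1 + c / (q : ℝ))) / k
      ≤ ∑ k ∈ Finset.Ioc ⌊x⌋₊ ⌊x'⌋₊, (∏ q ∈ k.primeFactors, (1 + c / (q : ℝ))) / k :=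
        Finset.sum_le_sum_of_subset_of_nonneg hsub fun k hk _ => hnonneg k hk
    _ ≤ C * ((x' - x) / x) := key
    _ = C * (Real.exp (3 * θ) - 1) := by
        rw [hx'eq]; field_simp
    _ ≤ C * (3 * (3 * θ)) := mul_le_mul_of_nonneg_left hexp3 hC0
    _ = 9 * C * θ := by ring

end Literature.NumberTheory.LFunctions.Zhang2022.WeightShortWindow
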